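import Mathlib.Analysis.SpecificLimits.Basic
import Mathlib.Algebra.Order.BigOperators.Group.Finset
import Mathlib.Tactic.Linarith
import Mathlib.Tactic.Positivity
import Mathlib.Tactic.Ring
import Mathlib.Tactic.FieldSimp

/-!
# `BalabanUV.Beta.GAN24.TowerBoundKFold` — binder row G-an2-4 ∕ (CONV-C), W-slot CT-W, route «WC-TL» ∕ (Q-R) «QR-LL» and (Q-L) «QL-LL» (RULING R-gan24p1-g25-1,
# design `HOME/b2b-balaban-gan24-p1/gen25/QR-DESIGN-v0.md`): **THE k₀-STEP TOWER SOCKET — a real tower whose k₀-FOLD iterate contracts (rate θ < 1) against bounded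
# sources is bounded UNIFORMLY in the level, whatever its ONE-step growth** (row owner `b2b-balaban-gan24-p1`, gen 25)

NOT IN PRINT; OUR BOOKKEEPING ([folklore] real analysis: a geometric series and Euclidean division; 0 cited facts, 0 `def`, 0 `def … : Prop`, 0 sorry).  HONEST FRAMING (cell
contract, verbatim): «discharging `BetaPertH` makes Bałaban's UV stability UNCONDITIONAL — a real constructive-QFT result; it is NOT the continuum limit and NOT the Clay problem.»
HONEST DEPENDENCY (verbatim): «continuum YM on T⁴ ⇐ BetaPertH ∧ nine spine estimates (0/9 proved); BetaPertH ⇐ (D1) ∧ (D4) ∧ CAP+tail; G-an2-4 gates asym, D1 and NE2/3/4.»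

WHY.  CT-W's located rows (Q-R) (Ward-locus remainder tower) and (Q-L) (leg storeys) are LINEAR towers whose ONE-step map is exactly MARGINAL at the engine's `Lc = 3`
(idea-1 g33 `WARD6-GAN24.md` §2∕§4: one-step layer factor `2(d+1)ϱ∕Lc ≥ 8∕3`; the OWNER's R7∕R8∕R9): no one-step socket `‖𝒜‖ ≤ θ < 1` can hold there.  What the LAYER
mechanism gives instead is a gain `Lc^{−k}` on the `k`-FOLD iterate ((LT) «layer transport», road S3's row-V count; for the legs idea-1's (Q-L-k₀): `C_E(k₀)·Lc^{−k₀}·(…) ≤ ½`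
for SOME `k₀`).  This file is the generic END those estimates feed: a sequence `a : ℕ → ℝ` with `a (n + k₀) ≤ θ·a n + s` for all `n` (`0 ≤ θ < 1`, `0 ≤ s`) and `a i ≤ M` on
the first window `i < k₀` (`0 ≤ M`) satisfies `a n ≤ M + s∕(1 − θ)` for EVERY `n` — NO hypothesis on the one-step growth; plus the ℓ¹ reduction of a finite SYSTEM of towers
(the (L, R, LR) leg storeys) to one scalar tower.  Pure real analysis: no kernel, no table, no lattice.

## What is proved ([folklore])
* §1 `geom_sum_le_inv_one_sub` (`Σ_{i<q} θ^i ≤ (1 − θ)⁻¹`), `window_bound` (`a (k₀·q + r) ≤ θ^q·M + s·Σ_{i<q} θ^i` for `r < k₀`), **`towerBound_of_kfold`**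
  (`∀ n, a n ≤ M + s·(1 − θ)⁻¹`).
* §3 **`good_finset_sum`**, **`unrolled_bound`** — THE UNROLLED FORM (QR-LL's (DUH)): for an abstract SIZE predicate `Good : E → ℝ → Prop` on an additive monoid that is
  subadditive (`Good X c → Good X′ c′ → Good (X + X′) (c + c′)`), monotone in the constant and holds at `(0, 0)` — e.g. `LocStencil`-type classes at fixed rate — terms
  `X i`, `i ≤ k`, of sizes `C·θ^(k−i)` sum to a term of size `C·(1 − θ)⁻¹`, UNIFORMLY in `k` (the transported layer letters of (REP) after (LAY)∘(LT)).
* §2 **`sum_step_of_matrix`** — ℓ¹ REDUCTION: finitely many nonnegative towers `a ℓ` with `a ℓ (n + k₀) ≤ Σ_{ℓ′} Θ ℓ ℓ′ · a ℓ′ n + s ℓ` and COLUMN sums `Σ_ℓ Θ ℓ ℓ′ ≤ θ`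
  (no sign condition on `Θ` is needed) ⇒ the total `Σ_ℓ a ℓ n` obeys the scalar step `(Σ_ℓ a ℓ (n + k₀)) ≤ θ·(Σ_ℓ a ℓ n) + Σ_ℓ s ℓ`; **`towerBound_system_of_kfold`** — hence every
  component is bounded by `M + (Σ_ℓ s ℓ)·(1 − θ)⁻¹` uniformly in `n` (`M` a bound of the totals on the first window); **`towerBound_system_of_kfold_weighted`** —
  the same under POSITIVE WEIGHTS `w` with weighted column sums `Σ_ℓ w ℓ·Θ ℓ ℓ′ ≤ θ·w ℓ′` (the shape a block-TRIANGULAR system with O(1) feed constants needs —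
  idea-1 g34's rider (r1); Collatz–Wielandt): `a ℓ n ≤ (w ℓ)⁻¹·(M + (Σ_ℓ w ℓ·s ℓ)·(1 − θ)⁻¹)`.
Discharges NOTHING of (Q-R) ∕ (Q-L) ∕ (C) ∕ «T2Shape» ∕ «T2Drift» ∕ (hW, hWall): the k₀-fold contraction is the HYPOTHESIS ((LT) ∕ (Q-L-k₀) are the open estimates); NEVER «G-an2-4
closed» as (CONV-C); NOT D1, NOT `BetaPertH`, NOT continuum, NOT Clay.  2026-08-22.
-/

open Finset
open scoped BigOperators

namespace Summit.QuantumFields.BalabanUV.Beta.GAN24.TowerBoundKFold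

/-! ## §1 One scalar tower with a k₀-fold contraction -/

/-- [folklore] The partial geometric sums of a ratio `0 ≤ θ < 1` are bounded by `(1 − θ)⁻¹`. -/
theorem geom_sum_le_inv_one_sub {θ : ℝ} (hθ0 : 0 ≤ θ) (hθ1 : θ < 1) (q : ℕ) :
    ∑ i ∈ range q, θ ^ i ≤ (1 - θ)⁻¹ := by
  have h1 : 0 < 1 - θ := by linarith
  rw [inv_eq_one_div, le_div_iff₀ h1, geom_sum_mul_neg θ q]
  linarith [pow_nonneg hθ0 q]

/-- [folklore] **THE WINDOW BOUND**: if `a (n + k₀) ≤ θ·a n + s` for every `n` (`0 ≤ θ`) and `a r ≤ M` for `r < k₀`, then along the arithmetic progression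
`k₀·q + r` the tower is bounded by the transient `θ^q·M` plus the accumulated sources `s·Σ_{i<q} θ^i`. -/
theorem window_bound {a : ℕ → ℝ} {k₀ : ℕ} {θ s M : ℝ} (hθ0 : 0 ≤ θ) (ha0 : ∀ r, r < k₀ → a r ≤ M)
    (hstep : ∀ n, a (n + k₀) ≤ θ * a n + s) (q r : ℕ) (hr : r < k₀) :
    a (k₀ * q + r) ≤ θ ^ q * M + s * ∑ i ∈ range q, θ ^ i := by
  induction q with
  | zero => simpa using ha0 r hr
  | succ q ih =>
      have e : k₀ * (q + 1) + r = (k₀ * q + r) + k₀ := by ring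
      rw [e]
      refine (hstep _).trans ?_
      have h2 : θ * a (k₀ * q + r) ≤ θ * (θ ^ q * M + s * ∑ i ∈ range q, θ ^ i) := mul_le_mul_of_nonneg_left ih hθ0
      have key : θ ^ (q + 1) * M + s * ∑ i ∈ range (q + 1), θ ^ i = θ * (θ ^ q * M + s * ∑ i ∈ range q, θ ^ i) + s := by
        rw [Finset.sum_range_succ', pow_zero, pow_succ]
        have : ∑ i ∈ range q, θ ^ (i + 1) = ∑ i ∈ range q, θ * θ ^ i := Finset.sum_congr rfl (fun i _ => by ring)
        rw [this, ← Finset.mul_sum]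
        ring
      rw [key]
      linarith

/-- [folklore] **THE k₀-STEP TOWER SOCKET.**  A real tower `a` with the k₀-FOLD step `a (n + k₀) ≤ θ·a n + s` (`0 ≤ θ < 1`, `0 ≤ s`, `0 < k₀`) for every `n`, bounded by
`M ≥ 0` on the first window `i < k₀`, is bounded by `M + s·(1 − θ)⁻¹` at EVERY level — whatever the one-step growth of `a`.  (The consumer: (Q-R)'s unrolled layer transport
∕ (Q-L-k₀)'s k₀-step Gronwall, at `d = 3`; idea-1's «towerBound_of_kfold».) -/
theorem towerBound_of_kfold {a : ℕ → ℝ} {k₀ : ℕ} (hk : 0 < k₀) {θ s M : ℝ} (hθ0 : 0 ≤ θ) (hθ1 : θ < 1) (hs : 0 ≤ s) (hM : 0 ≤ M)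
    (ha0 : ∀ r, r < k₀ → a r ≤ M) (hstep : ∀ n, a (n + k₀) ≤ θ * a n + s) (n : ℕ) :
    a n ≤ M + s * (1 - θ)⁻¹ := by
  have hn : n = k₀ * (n / k₀) + n % k₀ := (Nat.div_add_mod n k₀).symm
  rw [hn]
  refine (window_bound hθ0 ha0 hstep (n / k₀) (n % k₀) (Nat.mod_lt n hk)).trans ?_
  have h1 : θ ^ (n / k₀) * M ≤ M := by
    have : θ ^ (n / k₀) ≤ 1 := pow_le_one₀ hθ0 hθ1.le
    nlinarith
  have h2 : s * ∑ i ∈ range (n / k₀), θ ^ i ≤ s * (1 - θ)⁻¹ :=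
    mul_le_mul_of_nonneg_left (geom_sum_le_inv_one_sub hθ0 hθ1 _) hs
  linarith

/-! ## §2 A finite system of towers: ℓ¹ reduction to one scalar tower -/

/-- [folklore] **ℓ¹ REDUCTION OF A SYSTEM STEP**: nonnegative towers `a ℓ` (`ℓ` in a finite index type) with the matrix step
`a ℓ (n + k₀) ≤ Σ_{ℓ′} Θ ℓ ℓ′ · a ℓ′ n + s ℓ` and COLUMN sums `Σ_ℓ Θ ℓ ℓ′ ≤ θ` have totals obeying the scalar step `Σ_ℓ a ℓ (n + k₀) ≤ θ·Σ_ℓ a ℓ n + Σ_ℓ s ℓ`. -/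
theorem sum_step_of_matrix {ι : Type*} [Fintype ι] {a : ι → ℕ → ℝ} {k₀ : ℕ} {Θ : ι → ι → ℝ} {s : ι → ℝ} {θ : ℝ}
    (hpos : ∀ ℓ n, 0 ≤ a ℓ n) (hcol : ∀ ℓ', ∑ ℓ, Θ ℓ ℓ' ≤ θ)
    (hstep : ∀ ℓ n, a ℓ (n + k₀) ≤ ∑ ℓ', Θ ℓ ℓ' * a ℓ' n + s ℓ) (n : ℕ) :
    ∑ ℓ, a ℓ (n + k₀) ≤ θ * ∑ ℓ, a ℓ n + ∑ ℓ, s ℓ := by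
  calc ∑ ℓ, a ℓ (n + k₀) ≤ ∑ ℓ, (∑ ℓ', Θ ℓ ℓ' * a ℓ' n + s ℓ) := Finset.sum_le_sum fun ℓ _ => hstep ℓ n
    _ = ∑ ℓ', (∑ ℓ, Θ ℓ ℓ') * a ℓ' n + ∑ ℓ, s ℓ := by
        rw [Finset.sum_add_distrib, Finset.sum_comm]
        congr 1
        exact Finset.sum_congr rfl fun ℓ' _ => by rw [Finset.sum_mul]
    _ ≤ ∑ ℓ', θ * a ℓ' n + ∑ ℓ, s ℓ := by
        exact add_le_add (Finset.sum_le_sum fun ℓ' _ => mul_le_mul_of_nonneg_right (hcol ℓ') (hpos ℓ' n)) le_rfl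
    _ = θ * ∑ ℓ, a ℓ n + ∑ ℓ, s ℓ := by rw [Finset.mul_sum]

/-- [folklore] **THE k₀-STEP TOWER SOCKET FOR A FINITE SYSTEM** (the (L, R, LR) leg storeys of (Q-L)): under the hypotheses of `sum_step_of_matrix` with `0 ≤ θ < 1`, `0 ≤ s`,
`0 < k₀`, and the totals bounded by `M ≥ 0` on the first window, EVERY component is bounded by `M + (Σ_ℓ s ℓ)·(1 − θ)⁻¹` at every level. -/
theorem towerBound_system_of_kfold {ι : Type*} [Fintype ι] {a : ι → ℕ → ℝ} {k₀ : ℕ} (hk : 0 < k₀) {Θ : ι → ι → ℝ} {s : ι → ℝ} {θ M : ℝ}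
    (hθ0 : 0 ≤ θ) (hθ1 : θ < 1) (hs : ∀ ℓ, 0 ≤ s ℓ) (hM : 0 ≤ M)
    (hpos : ∀ ℓ n, 0 ≤ a ℓ n) (hcol : ∀ ℓ', ∑ ℓ, Θ ℓ ℓ' ≤ θ)
    (ha0 : ∀ r, r < k₀ → ∑ ℓ, a ℓ r ≤ M) (hstep : ∀ ℓ n, a ℓ (n + k₀) ≤ ∑ ℓ', Θ ℓ ℓ' * a ℓ' n + s ℓ) (ℓ : ι) (n : ℕ) :
    a ℓ n ≤ M + (∑ ℓ', s ℓ') * (1 - θ)⁻¹ := by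
  have hle : a ℓ n ≤ ∑ ℓ', a ℓ' n := Finset.single_le_sum (fun ℓ' _ => hpos ℓ' n) (Finset.mem_univ ℓ)
  refine hle.trans ?_
  exact towerBound_of_kfold (a := fun n => ∑ ℓ', a ℓ' n) hk hθ0 hθ1 (Finset.sum_nonneg fun ℓ' _ => hs ℓ') hM ha0
    (fun n => sum_step_of_matrix hpos hcol hstep n) n

/-- [folklore] **WEIGHTED SYSTEM SOCKET** (idea-1 g34's rider (r1): the (L, R, LR) leg system is block-TRIANGULAR with O(1) feed constants, so UNWEIGHTED column sums need not be
`≤ θ` even when every diagonal factor is; positive weights `w` with WEIGHTED column sums `Σ_ℓ w ℓ·Θ ℓ ℓ′ ≤ θ·w ℓ′` exist iff the spectral radius of the nonnegative part is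
`≤ θ` — Collatz–Wielandt; for a triangular `Θ` with diagonal `≤ b < θ` take the lower storeys' weights small): under such weights every component satisfies
`a ℓ n ≤ (w ℓ)⁻¹·(M + (Σ_ℓ w ℓ·s ℓ)·(1 − θ)⁻¹)`, `M` a bound of the WEIGHTED totals on the first window.  (= `towerBound_system_of_kfold` for the rescaled towers `w ℓ·a ℓ`.) -/
theorem towerBound_system_of_kfold_weighted {ι : Type*} [Fintype ι] {a : ι → ℕ → ℝ} {k₀ : ℕ} (hk : 0 < k₀) {Θ : ι → ι → ℝ} {s w : ι → ℝ} {θ M : ℝ}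
    (hθ0 : 0 ≤ θ) (hθ1 : θ < 1) (hs : ∀ ℓ, 0 ≤ s ℓ) (hM : 0 ≤ M) (hpos : ∀ ℓ n, 0 ≤ a ℓ n) (hw : ∀ ℓ, 0 < w ℓ)
    (hcolw : ∀ ℓ', ∑ ℓ, w ℓ * Θ ℓ ℓ' ≤ θ * w ℓ') (ha0 : ∀ r, r < k₀ → ∑ ℓ, w ℓ * a ℓ r ≤ M)
    (hstep : ∀ ℓ n, a ℓ (n + k₀) ≤ ∑ ℓ', Θ ℓ ℓ' * a ℓ' n + s ℓ) (ℓ : ι) (n : ℕ) :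
    a ℓ n ≤ (w ℓ)⁻¹ * (M + (∑ ℓ', w ℓ' * s ℓ') * (1 - θ)⁻¹) := by
  have hwne : ∀ ℓ, w ℓ ≠ 0 := fun ℓ => (hw ℓ).ne'
  -- the rescaled system
  have key : w ℓ * a ℓ n ≤ M + (∑ ℓ', w ℓ' * s ℓ') * (1 - θ)⁻¹ := by
    refine towerBound_system_of_kfold (a := fun ℓ n => w ℓ * a ℓ n) (Θ := fun ℓ ℓ' => w ℓ * Θ ℓ ℓ' * (w ℓ')⁻¹) (s := fun ℓ => w ℓ * s ℓ)
      hk hθ0 hθ1 (fun ℓ => mul_nonneg (hw ℓ).le (hs ℓ)) hM (fun ℓ n => mul_nonneg (hw ℓ).le (hpos ℓ n)) ?_ ha0 ?_ ℓ n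
    · intro ℓ'
      have h1 : ∑ ℓ, w ℓ * Θ ℓ ℓ' * (w ℓ')⁻¹ = (∑ ℓ, w ℓ * Θ ℓ ℓ') * (w ℓ')⁻¹ := by rw [Finset.sum_mul]
      rw [h1]
      calc (∑ ℓ, w ℓ * Θ ℓ ℓ') * (w ℓ')⁻¹ ≤ θ * w ℓ' * (w ℓ')⁻¹ :=
            mul_le_mul_of_nonneg_right (hcolw ℓ') (inv_nonneg.mpr (hw ℓ').le)
        _ = θ := by rw [mul_assoc, mul_inv_cancel₀ (hwne ℓ'), mul_one]
    · intro ℓ n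
      have h2 : w ℓ * a ℓ (n + k₀) ≤ w ℓ * (∑ ℓ', Θ ℓ ℓ' * a ℓ' n + s ℓ) := mul_le_mul_of_nonneg_left (hstep ℓ n) (hw ℓ).le
      have h3 : w ℓ * (∑ ℓ', Θ ℓ ℓ' * a ℓ' n + s ℓ) = ∑ ℓ', w ℓ * Θ ℓ ℓ' * (w ℓ')⁻¹ * (w ℓ' * a ℓ' n) + w ℓ * s ℓ := by
        rw [mul_add, Finset.mul_sum]
        congr 1
        refine Finset.sum_congr rfl fun ℓ' _ => ?_
        have : (w ℓ')⁻¹ * w ℓ' = 1 := inv_mul_cancel₀ (hwne ℓ')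
        calc w ℓ * (Θ ℓ ℓ' * a ℓ' n) = w ℓ * Θ ℓ ℓ' * ((w ℓ')⁻¹ * w ℓ') * a ℓ' n := by rw [this]; ring
          _ = w ℓ * Θ ℓ ℓ' * (w ℓ')⁻¹ * (w ℓ' * a ℓ' n) := by ring
      simpa only [h3] using h2
  rw [inv_mul_eq_div, le_div_iff₀ (hw ℓ), mul_comm]
  exact key

/-! ## §3 The unrolled form: finitely many geometrically weighted terms under a subadditive size predicate -/

section Unrolled

variable {E : Type*} [AddCommMonoid E]

/-- [folklore] **SUBADDITIVE SIZE OF A FINITE SUM**: if `Good` holds at `(0,0)` and is subadditive, and `Good (X i) (c i)` for every `i ∈ s`, then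
`Good (Σ_{i∈s} X i) (Σ_{i∈s} c i)`. -/
theorem good_finset_sum {ι : Type*} (Good : E → ℝ → Prop) (h0 : Good 0 0)
    (hadd : ∀ X X' c c', Good X c → Good X' c' → Good (X + X') (c + c')) (s : Finset ι) (X : ι → E) (c : ι → ℝ)
    (h : ∀ i ∈ s, Good (X i) (c i)) : Good (∑ i ∈ s, X i) (∑ i ∈ s, c i) := by
  classical
  induction s using Finset.induction_on with
  | empty => simpa using h0
  | insert a s ha ih =>
      rw [Finset.sum_insert ha, Finset.sum_insert ha]
      exact hadd _ _ _ _ (h a (Finset.mem_insert_self a s)) (ih fun i hi => h i (Finset.mem_insert_of_mem hi))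

/-- [folklore] **THE UNROLLED TOWER SOCKET** (QR-LL's (DUH)): under a subadditive, monotone size predicate `Good` with `Good 0 0`, if the `k+1` terms `X i` (`i ≤ k`; the
layer letters of level `i` transported to level `k`) have sizes `C·θ^(k−i)` (`0 ≤ θ < 1`, `0 ≤ C` — what (LAY)∘(LT) deliver: a gain `θ = Lc⁻¹` per level of separation), then
their sum (the level-`k` remainder, by (REP)) has size `C·(1 − θ)⁻¹` — UNIFORMLY IN `k`. -/
theorem unrolled_bound (Good : E → ℝ → Prop) (h0 : Good 0 0)
    (hadd : ∀ X X' c c', Good X c → Good X' c' → Good (X + X') (c + c')) (hmono : ∀ X c c', c ≤ c' → Good X c → Good X c')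
    {θ C : ℝ} (hθ0 : 0 ≤ θ) (hθ1 : θ < 1) (hC : 0 ≤ C) (k : ℕ) (X : ℕ → E)
    (hX : ∀ i ∈ range (k + 1), Good (X i) (C * θ ^ (k - i))) :
    Good (∑ i ∈ range (k + 1), X i) (C * (1 - θ)⁻¹) := by
  have h1 := good_finset_sum Good h0 hadd (range (k + 1)) X (fun i => C * θ ^ (k - i)) hX
  refine hmono _ _ _ ?_ h1
  rw [← Finset.mul_sum]
  refine mul_le_mul_of_nonneg_left ?_ hC
  have e : ∑ i ∈ range (k + 1), θ ^ (k - i) = ∑ i ∈ range (k + 1), θ ^ i := by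
    rw [← Finset.sum_range_reflect (fun i => θ ^ i) (k + 1)]
    refine Finset.sum_congr rfl fun i _ => ?_
    simp only [Nat.add_sub_cancel]
  rw [e]
  exact geom_sum_le_inv_one_sub hθ0 hθ1 (k + 1)

end Unrolled

end Summit.QuantumFields.BalabanUV.Beta.GAN24.TowerBoundKFold
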